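import Summits.HubbardSuperconductivity.HubbardSuperconductivity.Theorems.AnisotropyChordTowerIdentities

/-!
# Route `AnisotropyChord` / H0 rotor rung: THE TOWER LADDER — unrolled ladder and the conditional window theorem
# (port of theory seat `hubbard-h0-rotor-theory-1`, cycle 11, `Sketch11.lean` Parts B–C, memo ROTOR-THEORY-11 §150;
# work-order v11e)

* Part B: real-sequence ladder bounds `ladder_bound`, `ladder_bound_uniform`, `one_sub_pow_ge`;
* Part C: typed support statements `PerronSectorSupport`, `PerronSectorDownward`, the **HALF-FILLING ANCHOR**
  `HalfFillingAnchor Δ c₀` (a theorem at `Δ = 0`: Kennedy–Lieb–Shastry 1988), the **TOWER-FIDELITY WINDOW** hypothesis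
  `TowerFidelityWindow Δ δ` (OPEN; CAVEAT memo §148(d): `1 − Z ≤ C/|V|` is `d = 2`-disfavoured — the two-phonon
  Debye–Waller sum makes it `(a + b log L)/|V|`; ED 1 − Z₊ at ρ = ¼ not decreasing in V), `CondensateOnWindow`, and the
  PROVED implication `condensateOnWindow_of_towerFidelity` (anchor ∧ tower fidelity on the window ⇒ condensation on a
  window off half filling).  Typing/proof authority: theory seat.
-/

set_option linter.dupNamespace false
set_option autoImplicit false

noncomputable section

open Finset Filter Topology
open Summit.HubbardSuperconductivity.HubbardSuperconductivity.Theorems.AnisotropyChord.InsertionEntropy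
open Literature.MathematicalPhysics.QuantumLattice Literature.Probability.LatticeModels

namespace Summit.HubbardSuperconductivity.HubbardSuperconductivity.Theorems.AnisotropyChord.Tower

/-! ## Part B — the unrolled ladder (real sequences) -/

section Ladder

/-- **LADDER LEMMA.**  `Λ₀ ≥ 0`, `0 ≤ z_k ≤ 1`, `Λ_{k+1} ≥ z_k (Λ_k − 2k)` for `k < m`
⇒ `Λ_m ≥ (∏_{k<m} z_k) Λ₀ − m(m−1)`.  (The recursion is the one-step ladder started at half filling
`n₀ = |V|/2`, where the commutator gain is `|V| − 2(n₀+k) = −2k`; below half filling the gain only helps.) [folklore] -/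
theorem ladder_bound (Λ z : ℕ → ℝ) (_h0 : 0 ≤ Λ 0) (hz0 : ∀ k, 0 ≤ z k) (hz1 : ∀ k, z k ≤ 1) :
    ∀ m : ℕ, (∀ k, k < m → z k * (Λ k - 2 * k) ≤ Λ (k + 1)) →
      (∏ k ∈ Finset.range m, z k) * Λ 0 - (m : ℝ) * ((m : ℝ) - 1) ≤ Λ m := by
  intro m
  induction m with
  | zero => intro _; simp
  | succ k ih =>
    intro hrec
    have ih := ih (fun i hi => hrec i (Nat.lt_succ_of_lt hi))
    rw [Finset.prod_range_succ]
    have hP0 : 0 ≤ ∏ j ∈ Finset.range k, z j := Finset.prod_nonneg fun j _ => hz0 j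
    have hk : (0 : ℝ) ≤ k := Nat.cast_nonneg k
    have step := hrec k (Nat.lt_succ_self k)
    -- z_k (Λ_k − 2k) ≥ z_k (P_k Λ₀ − k(k−1) − 2k) = P_{k+1} Λ₀ − z_k k(k+1) ≥ P_{k+1} Λ₀ − k(k+1)
    have h1 : z k * ((∏ j ∈ Finset.range k, z j) * Λ 0 - (k : ℝ) * ((k : ℝ) - 1) - 2 * k)
        ≤ z k * (Λ k - 2 * k) := mul_le_mul_of_nonneg_left (by linarith) (hz0 k)
    have h2 : (k : ℝ) * ((k : ℝ) - 1) + 2 * k = (k : ℝ) * ((k : ℝ) + 1) := by ring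
    have h3 : z k * ((k : ℝ) * ((k : ℝ) + 1)) ≤ (k : ℝ) * ((k : ℝ) + 1) := by
      have : 0 ≤ (k : ℝ) * ((k : ℝ) + 1) := by positivity
      nlinarith [hz1 k]
    push_cast
    nlinarith [h1, h3, hP0, _h0]

/-- Uniform-fidelity corollary: `z_k ≥ ζ ≥ 0` for `k < m` ⇒ `Λ_m ≥ ζ^m Λ₀ − m(m−1)`. [folklore] -/
theorem ladder_bound_uniform (Λ z : ℕ → ℝ) (ζ : ℝ) (m : ℕ) (h0 : 0 ≤ Λ 0) (hζ : 0 ≤ ζ)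
    (hz0 : ∀ k, 0 ≤ z k) (hz1 : ∀ k, z k ≤ 1) (hzζ : ∀ k, k < m → ζ ≤ z k)
    (hrec : ∀ k, k < m → z k * (Λ k - 2 * k) ≤ Λ (k + 1)) :
    ζ ^ m * Λ 0 - (m : ℝ) * ((m : ℝ) - 1) ≤ Λ m := by
  have h := ladder_bound Λ z h0 hz0 hz1 m hrec
  have hprod : ζ ^ m ≤ ∏ k ∈ Finset.range m, z k := by
    rw [← Finset.card_range m, ← Finset.prod_const, Finset.card_range]
    exact Finset.prod_le_prod (fun k _ => hζ) fun k hk => hzζ k (Finset.mem_range.1 hk)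
  nlinarith [hprod, h0]

/-- Bernoulli: `(1 − c/W)^m ≥ 1 − m c / W` for `0 ≤ c/W ≤ 1`. [folklore] -/
theorem one_sub_pow_ge (t : ℝ) (m : ℕ) (_ht0 : 0 ≤ t) (ht1 : t ≤ 1) : 1 - (m : ℝ) * t ≤ (1 - t) ^ m := by
  have h := one_add_mul_le_pow (show (-2 : ℝ) ≤ -t by linarith) m
  rw [show (1 : ℝ) + -t = 1 - t by ring] at h
  linarith [h]

end Ladder

/-! ## Part C — typed hypotheses in the tree's currency and the CONDITIONAL WINDOW THEOREM -/

section Window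

/-- SUPPORT STATEMENT (provable; port): a Perron amplitude of the sector `Sᶻ_tot = M` is supported on
configurations with `|V|/2 + M` particles (`spinZSector n M` is the eigenspace of the total `Sᶻ`, diagonal in
the configuration basis with eigenvalue `#{x : σ x = 0} − |V|/2` for spin ½).
[conjecture: theory seat hubbard-h0-rotor-theory-1, cycle 11 — support statement (provable)] -/
def PerronSectorSupport (Δ : ℝ) : Prop :=
  ∀ (L : ℕ) [NeZero L] (M : ℝ) (a : TensorIndex (TorusSite 2 L) 2 → ℝ),
    IsPerronSectorGroundAmplitude L Δ M a →
      ∀ σ, a σ ≠ 0 → ((univ.filter fun x => σ x = 0).card : ℝ) = (Fintype.card (TorusSite 2 L) : ℝ) / 2 + M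

/-- SUPPORT STATEMENT (provable; port): if the sector `M + 1` (`M ≥ 0`) carries a Perron ground amplitude,
so does the sector `M` (stoquasticity + Perron–Frobenius on the non-empty connected sector graph).
[conjecture: theory seat hubbard-h0-rotor-theory-1, cycle 11 — support statement (provable)] -/
def PerronSectorDownward (Δ : ℝ) : Prop :=
  ∀ (L : ℕ) [NeZero L] (M : ℝ), 0 ≤ M →
    (∃ a : TensorIndex (TorusSite 2 L) 2 → ℝ, IsPerronSectorGroundAmplitude L Δ (M + 1) a) →
      ∃ b : TensorIndex (TorusSite 2 L) 2 → ℝ, IsPerronSectorGroundAmplitude L Δ M b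

/-- **HALF-FILLING ANCHOR** with floor `c₀`: eventually in `L`, every Perron amplitude of the sector
`Sᶻ_tot = 0` (half filling) has condensate density `≥ c₀`.  At `Δ = 0` this is Kennedy–Lieb–Shastry 1988
(tree: `kennedy_lieb_shastry_xy_ground_holds`, even `L`; odd `L` is vacuous — the sector is empty) up to the
identification of the tracial ground-state functional with the `Sᶻ = 0` Perron state (uniqueness; port).
It is `EventualCondensate Δ 0` with the constant exposed.
[conjecture: theory seat hubbard-h0-rotor-theory-1, cycle 11 — anchor (a theorem at Δ = 0, KLS1988PRL)] -/
def HalfFillingAnchor (Δ c₀ : ℝ) : Prop :=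
  ∀ᶠ L : ℕ in atTop, ∀ [NeZero L], ∀ a : TensorIndex (TorusSite 2 L) 2 → ℝ,
    IsPerronSectorGroundAmplitude L Δ 0 a → c₀ ≤ condensateDensity a

/-- **THE TOWER-FIDELITY WINDOW HYPOTHESIS `T_δ` (OPEN).**  There is `C` such that, eventually in `L`, for
every integer sector `0 ≤ j < δ|V|` and all Perron amplitudes `b` (sector `j`) and `a` (sector `j+1`) of `H(Δ)`:
`Z(b → a) = ⟨a, S⁺_tot b⟩² / ‖S⁺_tot b‖² ≥ 1 − C/|V|` — the one-step Anderson-tower state `S⁺_tot b / ‖·‖` is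
the next sector's ground state up to an `O(1/|V|)` infidelity.  Bogoliubov heuristics: `1 − Z ≈ g/(16 ρ |V|)`
(flat incoherent `k = 0` addition weight); ED (kit j309316, TOWER-TABLE): `|V|(1 − Z)` measured on 4×4 … 6×6.
[conjecture: theory seat hubbard-h0-rotor-theory-1, cycle 11, memo ROTOR-THEORY-11 §149; OPEN] -/
def TowerFidelityWindow (Δ δ : ℝ) : Prop :=
  ∃ C : ℝ, ∀ᶠ L : ℕ in atTop, ∀ [NeZero L], ∀ j : ℕ, (j : ℝ) < δ * (Fintype.card (TorusSite 2 L) : ℝ) →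
    ∀ b a : TensorIndex (TorusSite 2 L) 2 → ℝ,
      IsPerronSectorGroundAmplitude L Δ (j : ℝ) b → IsPerronSectorGroundAmplitude L Δ ((j : ℝ) + 1) a →
        1 - C / (Fintype.card (TorusSite 2 L) : ℝ) ≤ towerFidelity b a

/-- Conclusion shape: condensation with floor `c` on the magnetisation window `0 ≤ Sᶻ_tot ≤ δ|V|`
(densities `ρ ∈ [1/2, 1/2 + δ]`; the window below half filling follows by the spin-flip symmetry of `H(Δ)`).
[conjecture: theory seat hubbard-h0-rotor-theory-1, cycle 11 — target-side statement] -/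
def CondensateOnWindow (Δ δ c : ℝ) : Prop :=
  ∀ᶠ L : ℕ in atTop, ∀ [NeZero L], ∀ j : ℕ, (j : ℝ) ≤ δ * (Fintype.card (TorusSite 2 L) : ℝ) →
    ∀ a : TensorIndex (TorusSite 2 L) 2 → ℝ,
      IsPerronSectorGroundAmplitude L Δ (j : ℝ) a → c ≤ condensateDensity a

/-- **THEOREM (TOWER LADDER, conditional extension of condensation off half filling).**
half-filling anchor `c₀` ∧ tower fidelity `≥ 1 − C/|V|` on the window `δ` (+ the two provable support
statements) ⇒ condensation with floor `c₀/4` on the window `δ' = min(δ, 1/(2(C⁺+1)), √c₀/2)`.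
At `Δ = 0` the anchor is Kennedy–Lieb–Shastry, so `T_δ ⇒` BEC for hard-core bosons on `ℤ²` at all fillings
`|ρ − 1/2| ≤ δ'` — the case «expected … but proved only for `M_L = 0`» (Tasaki 2018, arXiv:1807.05847, §3.2).
[conjecture: theory seat hubbard-h0-rotor-theory-1, cycle 11, memo ROTOR-THEORY-11 §150 (the implication is proved here)] -/
theorem condensateOnWindow_of_towerFidelity (Δ δ c₀ : ℝ) (hδ : 0 < δ) (hc₀ : 0 < c₀)
    (hS : PerronSectorSupport Δ) (hD : PerronSectorDownward Δ)
    (hA : HalfFillingAnchor Δ c₀) (hT : TowerFidelityWindow Δ δ) :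
    ∃ δ' > 0, CondensateOnWindow Δ δ' (c₀ / 4) := by
  obtain ⟨C, hC⟩ := hT
  set C' := max C 0 with hC'def
  have hC'0 : 0 ≤ C' := le_max_right _ _
  have hCC' : C ≤ C' := le_max_left _ _
  set δ' := min δ (min (1 / (2 * (C' + 1))) (Real.sqrt c₀ / 2)) with hδ'def
  have hδ'pos : 0 < δ' := by positivity
  have hδ'δ : δ' ≤ δ := min_le_left _ _
  have hδ'C : δ' ≤ 1 / (2 * (C' + 1)) := le_trans (min_le_right _ _) (min_le_left _ _)
  have hδ'c : δ' ≤ Real.sqrt c₀ / 2 := le_trans (min_le_right _ _) (min_le_right _ _)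
  refine ⟨δ', hδ'pos, ?_⟩
  filter_upwards [hA, hC, eventually_ge_atTop (⌈C'⌉₊ + 1)] with L hAL hCL hL
  intro _ j hj a ha
  -- the volume
  set W := (Fintype.card (TorusSite 2 L) : ℝ) with hWdef
  have hW : W = (L : ℝ) ^ 2 := by
    rw [hWdef, Fintype.card_fun, ZMod.card, Fintype.card_fin]; push_cast; ring
  have hL1 : (1 : ℝ) ≤ L := by exact_mod_cast (by omega : 1 ≤ L)
  have hC'W : C' ≤ W := by
    have h1 : C' ≤ (⌈C'⌉₊ : ℝ) := Nat.le_ceil _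
    have h2 : (⌈C'⌉₊ : ℝ) + 1 ≤ L := by exact_mod_cast hL
    rw [hW]; nlinarith
  have hWpos : 0 < W := by rw [hW]; positivity
  -- a chain of Perron amplitudes b_0, …, b_j = a
  have hex : ∀ d i : ℕ, i + d = j →
      ∃ b : TensorIndex (TorusSite 2 L) 2 → ℝ, IsPerronSectorGroundAmplitude L Δ (i : ℝ) b := by
    intro d
    induction d with
    | zero => intro i hi; simp only [add_zero] at hi; subst hi; exact ⟨a, ha⟩
    | succ d ih =>
      intro i hi
      obtain ⟨a', ha'⟩ := ih (i + 1) (by omega)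
      have hcast : ((i + 1 : ℕ) : ℝ) = (i : ℝ) + 1 := by push_cast; ring
      rw [hcast] at ha'
      exact hD L (i : ℝ) (Nat.cast_nonneg i) ⟨a', ha'⟩
  have hex' : ∀ i : ℕ, i < j → ∃ b : TensorIndex (TorusSite 2 L) 2 → ℝ,
      IsPerronSectorGroundAmplitude L Δ (i : ℝ) b := fun i hi => hex (j - i) i (by omega)
  classical
  let bs : ℕ → (TensorIndex (TorusSite 2 L) 2 → ℝ) := fun i =>
    if h : i < j then (hex' i h).choose else a
  have hbs_lt : ∀ i (h : i < j), IsPerronSectorGroundAmplitude L Δ (i : ℝ) (bs i) := by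
    intro i h; simp only [bs, dif_pos h]; exact (hex' i h).choose_spec
  have hbs_j : bs j = a := by simp [bs]
  have hbs_le : ∀ i, i ≤ j → IsPerronSectorGroundAmplitude L Δ (i : ℝ) (bs i) := by
    intro i hi
    rcases lt_or_eq_of_le hi with h | h
    · exact hbs_lt i h
    · subst h; rw [hbs_j]; exact ha
  have hunit : ∀ k, ∑ σ, (bs k) σ ^ 2 = 1 := by
    intro k
    by_cases h : k < j
    · exact (hbs_lt k h).unit
    · simp only [bs, dif_neg h]; exact ha.unit
  -- the ladder sequences
  let Λ : ℕ → ℝ := fun i => lowerNormSq (bs i)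
  let z : ℕ → ℝ := fun i => towerFidelity (bs i) (bs (i + 1))
  have hz0 : ∀ k, 0 ≤ z k := fun k => towerFidelity_nonneg _ _
  have hz1 : ∀ k, z k ≤ 1 := fun k => by
    have := towerFidelity_le (bs k) (bs (k + 1)); rw [hunit (k + 1)] at this; exact this
  have hΛ0 : 0 ≤ Λ 0 := by simp only [Λ]; unfold lowerNormSq; positivity
  -- one-step ladder along the chain: z_i (Λ_i − 2 i) ≤ Λ_{i+1}
  have hrec : ∀ i, i < j → z i * (Λ i - 2 * i) ≤ Λ (i + 1) := by
    intro i hi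
    have hb := hbs_lt i hi
    have hsupp := hS L (i : ℝ) (bs i) hb
    have h := lowerNormSq_succ_ge (bs i) (bs (i + 1)) (W / 2 + i) (hunit i) hsupp
    have e : W - 2 * (W / 2 + i) = -(2 * (i : ℝ)) := by ring
    simp only [Λ, z]
    rw [e] at h
    linarith [h]
  -- fidelity floor on the chain
  set ζ := 1 - C' / W with hζdef
  have hζ0 : 0 ≤ ζ := by
    rw [hζdef, sub_nonneg, div_le_one hWpos]; exact hC'W
  have hjW : (j : ℝ) ≤ δ' * W := hj
  have hzζ : ∀ k, k < j → ζ ≤ z k := by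
    intro k hk
    have hkW : (k : ℝ) < δ * W := by
      have : (k : ℝ) < j := by exact_mod_cast hk
      nlinarith [hδ'δ, hWpos.le]
    have hfid := hCL k hkW (bs k) (bs (k + 1)) (hbs_lt k hk)
      (by have := hbs_le (k + 1) (by omega); push_cast at this; exact this)
    have hmono : 1 - C' / W ≤ 1 - C / W := by
      have := div_le_div_of_nonneg_right hCC' hWpos.le
      linarith
    exact le_trans hmono hfid
  have hlad := ladder_bound_uniform Λ z ζ j hΛ0 hζ0 hz0 hz1 hzζ hrec
  -- arithmetic: ζ^j ≥ 1 − j C'/W ≥ 1/2, Λ 0 ≥ c₀ W², j(j−1) ≤ (c₀/4) W²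
  have ht1 : C' / W ≤ 1 := (div_le_one hWpos).2 hC'W
  have ht0 : 0 ≤ C' / W := div_nonneg hC'0 hWpos.le
  have hbern := one_sub_pow_ge (C' / W) j ht0 ht1
  have hjC : (j : ℝ) * (C' / W) ≤ 1 / 2 := by
    have h1 : (j : ℝ) * (C' / W) ≤ δ' * C' := by
      rw [show (j : ℝ) * (C' / W) = (j : ℝ) / W * C' by ring]
      have : (j : ℝ) / W ≤ δ' := by rw [div_le_iff₀ hWpos]; exact hjW
      exact mul_le_mul_of_nonneg_right this hC'0
    have h2 : δ' * C' ≤ 1 / (2 * (C' + 1)) * C' := mul_le_mul_of_nonneg_right hδ'C hC'0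
    have h3 : 1 / (2 * (C' + 1)) * C' ≤ 1 / 2 := by
      rw [div_mul_eq_mul_div, one_mul, div_le_iff₀ (by positivity)]; linarith
    linarith
  have hζj : 1 / 2 ≤ ζ ^ j := by rw [hζdef]; linarith
  have hΛ0c : c₀ * W ^ 2 ≤ Λ 0 := by
    have h := hAL (bs 0) (by have := hbs_le 0 (Nat.zero_le _); push_cast at this; exact this)
    have : condensateDensity (bs 0) = Λ 0 / W ^ 2 := rfl
    rw [this, le_div_iff₀ (by positivity)] at h
    exact h
  have hjj : (j : ℝ) * ((j : ℝ) - 1) ≤ c₀ / 4 * W ^ 2 := by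
    have hj0 : (0 : ℝ) ≤ j := Nat.cast_nonneg j
    have h1 : (j : ℝ) * ((j : ℝ) - 1) ≤ (δ' * W) ^ 2 := by nlinarith
    have h2 : δ' ^ 2 ≤ c₀ / 4 := by
      have hs : Real.sqrt c₀ ^ 2 = c₀ := Real.sq_sqrt hc₀.le
      nlinarith [hδ'c, hδ'pos, Real.sqrt_nonneg c₀]
    nlinarith [h2, hWpos]
  have hfinal : c₀ / 4 * W ^ 2 ≤ Λ j := by nlinarith [hlad, hζj, hΛ0c, hjj, hWpos, hc₀]
  -- back to the condensate density of a = bs j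
  have : condensateDensity a = Λ j / W ^ 2 := by simp only [Λ]; rw [hbs_j]; rfl
  rw [this, le_div_iff₀ (by positivity)]
  exact hfinal

end Window

end Summit.HubbardSuperconductivity.HubbardSuperconductivity.Theorems.AnisotropyChord.Tower
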